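import Summits.HubbardSuperconductivity.HubbardLadder.Bounds.StiffnessFromEnergyBrackets
import HarnessLib

/-!
# Hubbard ladder — Bounds: stiffness ceilings from certified ENERGY BRACKETS, part 2 — the `t–t'` class
# (bounds.tex Thm 3 / Cor. hook with a second chord in `t'`, typed AND proved)


HONEST FRAMING (cell pub-hubbard): ladder R1–R4 with certified numbers; no claim on H/H₀. These
are bounds for MODEL CLASSES (the square-lattice Hubbard torus `hubbardTorus 2 L 1 U`, resp. the
`t–t'` torus `hubbardTorusTT' L 1 t' U`, every filling, every `U ≥ 0`); no materials claim.
Companion text: `pub-hubbard/paper/bounds.tex` §3 (Thm 3 = SHARPENING #2, "the hook from the R1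
energy table to a certified stiffness / T_c ceiling"); tables `pub-hubbard/pub-hubbard-bounds/BOUNDS.md`
(row T3) and `EXTREMISERS.md` §5a (the certified column this file justifies).

Part 2 of 3 (see `StiffnessFromEnergyBrackets.lean` for part 1 = the `t' = 0` torus and the notation
`E(U)`, `D(ψ)`, `K_x, K_y`; part 3 = `StiffnessFromEnergyBracketsTL.lean`, thermodynamic limit).

## What is proved (no `sorry`, no new axioms)

* `StiffnessCeilingFromEnergyBracketsTT'` / `…TT'_holds` — the `t–t'` class, `t' ≤ 0`: the `x`-twist
  floor is `ρ_s L² ≤ K_x + t' K_d` (every diagonal bond crosses the seam), so the rotation average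
  gives `ρ_s L² ≤ ¼⟨-T⟩ + ½ t' K_d`, and the extra `t' K_d ≥ 0` is bracketed by a SECOND chord, in
  `t'` (`∂E/∂t' = -2K_d`, lower bracket `L₃ ≤ E^{t t₃}(U)` at some `t₃ < t'`):
  `ρ_s L² ≤ (U (R - L₁)/(U - U₁) - Em + t' (R - L₃)/(t₃ - t')) / 4`.

References (keys of `lean/references.bib`): KomaTasaki1994 §1 (supergradient); HazraVermaRanderia2019
eqs. (2)–(6) and App. G; ParamekantiTrivediRanderia1998 eq. (3); ScalapinoWhiteZhang1993 §II;
LangerMattis1971 eqs. (3)–(5); LiebPRL1989 (sector reduction `E(2n) = E(2n, S^z = 0)`).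
-/

noncomputable section

namespace Summit.HubbardSuperconductivity.HubbardLadder.Bounds

open Matrix Finset Real Filter Topology
open Literature.MathematicalPhysics.QuantumLattice
open Literature.MathematicalPhysics.QuantumFieldTheory
open Literature.Probability.LatticeModels
open Literature.MathematicalPhysics.QuantumLattice.LangerMattis
open Literature.MathematicalPhysics.QuantumLattice.ThermodynamicLimit
open scoped ComplexOrder ComplexConjugate Topology

variable {L : ℕ} [NeZero L]

/-! ### The `t–t'` class -/

/-- The sector energy of the `t–t'` torus, `E^{tt'}_L(U; N, M)` (`t = 1`, fixed `t'`). -/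
def sectorEnergyTT' (L : ℕ) [NeZero L] (t' U : ℝ) (N : ℕ) (M : ℝ) : ℝ :=
  (hubbardTorusTT' L 1 t' U).minEnergyOn (szSector (Λ := FermionTorus 2 L) N M)

/-- The zero-flux `t–t'` envelope is the `(N_L, S^z = 0)` sector energy. -/
theorem fluxEnergyTT'_zero_eq_sectorEnergyTT' (t' U δ : ℝ) :
    fluxEnergyTT' L t' U δ 0 = sectorEnergyTT' L t' U (2 * ⌊(1 - δ) * (L : ℝ) ^ 2 / 2⌋₊) 0 := by
  rw [fluxEnergyTT'_eq, hubbardTorusTT'Flux_zero]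
  rfl

omit [NeZero L] in
/-- `H^{tt'}(U') = H^{tt'}(U) + (U' - U) Σ_x n_{x↑}n_{x↓}` in expectation:
`Re⟨ψ, H^{tt'}(U') ψ⟩ = Re⟨ψ, H^{tt'}(U) ψ⟩ + (U' - U) D(ψ)`. -/
theorem re_expect_hubbardTorusTT'_eq_add (t' U U' : ℝ) (ψ : Fock (Orb (FermionTorus 2 L))) :
    (star ψ ⬝ᵥ (hubbardTorusTT' L 1 t' U' *ᵥ ψ)).re =
      (star ψ ⬝ᵥ (hubbardTorusTT' L 1 t' U *ᵥ ψ)).re + (U' - U) * doubleOccExp ψ := by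
  simp only [hubbardTorusTT', Matrix.add_mulVec, dotProduct_add, Complex.add_re]
  rw [← hubbardTorus, ← hubbardTorus, re_expect_hubbardTorus_eq U' ψ, re_expect_hubbardTorus_eq U ψ]
  unfold doubleOccExp
  ring

/-- `Re⟨ψ, H^{tt'}(U) ψ⟩ = -2 (K_x + K_y + t' K_d)(ψ) + U D(ψ)` (`L ≥ 3`; `K_d = kinWeightDiag`, one
orientation per diagonal bond, both spins). -/
theorem re_expect_hubbardTorusTT'_eq_kin (hL : 3 ≤ L) (t' U : ℝ) (ψ : Fock (Orb (FermionTorus 2 L))) :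
    (star ψ ⬝ᵥ (hubbardTorusTT' L 1 t' U *ᵥ ψ)).re =
      -(2 * (kinWeightDir 0 ψ + kinWeightDir 1 ψ + t' * kinWeightDiag ψ)) + U * doubleOccExp ψ := by
  have hdiag : (star ψ ⬝ᵥ (hamiltonian (fermionTorusDiagGraph L) t' 0 *ᵥ ψ)).re =
      -(2 * t' * kinWeightDiag ψ) := by
    rw [hamiltonian_fermionTorusDiagGraph_eq_smul_diagPeierlsHopping hL t' 0]
    simp only [Complex.ofReal_zero, zero_smul, add_zero, Matrix.smul_mulVec, dotProduct_smul,
      smul_eq_mul, Complex.mul_re, Complex.neg_re, Complex.neg_im, Complex.ofReal_re,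
      Complex.ofReal_im, neg_zero, zero_mul, sub_zero,
      re_star_dotProduct_diagPeierlsHopping_const_mulVec, Complex.one_re, Complex.one_im,
      mul_one, mul_zero, sum_shiftKinWeight_eq_kinWeightDiag]
    ring
  simp only [hubbardTorusTT', Matrix.add_mulVec, dotProduct_add, Complex.add_re]
  rw [← hubbardTorus, re_expect_hubbardTorus_eq_kin hL U ψ, hdiag]
  ring

/-- The energy of a unit sector ground state of the `t–t'` torus is the sector energy. -/
theorem re_expect_eq_sectorEnergyTT' {t' U : ℝ} {N : ℕ} {M : ℝ} {ψ : Fock (Orb (FermionTorus 2 L))}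
    (hgs : IsGroundStateInSector (hubbardTorusTT' L 1 t' U) N M ψ) (h1 : star ψ ⬝ᵥ ψ = 1) :
    (star ψ ⬝ᵥ (hubbardTorusTT' L 1 t' U *ᵥ ψ)).re = sectorEnergyTT' L t' U N M := by
  rw [hgs.2.2, dotProduct_smul, h1, smul_eq_mul, mul_one, Complex.ofReal_re, sectorEnergyTT']

/-- **Chord inequality, `t–t'` class**: `E^{tt'}(U') ≤ E^{tt'}(U) + (U' - U) D(ψ)` for a unit sector
ground state `ψ` at coupling `U` (fixed `t'`). -/
theorem sectorEnergyTT'_le_add_mul_doubleOccExp {t' U : ℝ} {N : ℕ} {M : ℝ}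
    {ψ : Fock (Orb (FermionTorus 2 L))} (hgs : IsGroundStateInSector (hubbardTorusTT' L 1 t' U) N M ψ)
    (h1 : star ψ ⬝ᵥ ψ = 1) (U' : ℝ) :
    sectorEnergyTT' L t' U' N M ≤ sectorEnergyTT' L t' U N M + (U' - U) * doubleOccExp ψ := by
  have h := minEnergyOn_le_rayleigh_of_mem (hubbardTorusTT'_isHermitian L 1 t' U') _ hgs.1 h1
  rw [re_expect_hubbardTorusTT'_eq_add t' U U' ψ, re_expect_eq_sectorEnergyTT' hgs h1] at h
  exact h

/-- **Upper kinetic bracket, `t–t'` class**: `2(K_x + K_y + t' K_d)(ψ) ≤ U (R - L₁)/(U - U₁) - Em`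
for every unit sector ground state `ψ` at `U ≥ 0`, with brackets `Em ≤ E^{tt'}(U) ≤ R`,
`L₁ ≤ E^{tt'}(U₁)`, `U₁ < U` (same `t'`). -/
theorem two_mul_kinWeightTT'_le_of_energyBrackets (hL : 3 ≤ L) {t' U U₁ : ℝ} (hU : 0 ≤ U)
    (hU₁ : U₁ < U) {N : ℕ} {M : ℝ} {ψ : Fock (Orb (FermionTorus 2 L))}
    (hgs : IsGroundStateInSector (hubbardTorusTT' L 1 t' U) N M ψ) (h1 : star ψ ⬝ᵥ ψ = 1)
    {Em R L₁ : ℝ} (hEm : Em ≤ sectorEnergyTT' L t' U N M) (hR : sectorEnergyTT' L t' U N M ≤ R)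
    (hL₁ : L₁ ≤ sectorEnergyTT' L t' U₁ N M) :
    2 * (kinWeightDir 0 ψ + kinWeightDir 1 ψ + t' * kinWeightDiag ψ) ≤
      U * ((R - L₁) / (U - U₁)) - Em := by
  have hkin : 2 * (kinWeightDir 0 ψ + kinWeightDir 1 ψ + t' * kinWeightDiag ψ) =
      U * doubleOccExp ψ - sectorEnergyTT' L t' U N M := by
    have h := re_expect_hubbardTorusTT'_eq_kin hL t' U ψ
    rw [re_expect_eq_sectorEnergyTT' hgs h1] at h
    linarith
  have hch := sectorEnergyTT'_le_add_mul_doubleOccExp hgs h1 U₁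
  have hd : 0 < U - U₁ := sub_pos.2 hU₁
  have hD : doubleOccExp ψ ≤ (R - L₁) / (U - U₁) := by
    rw [le_div_iff₀ hd]
    nlinarith [hch, hR, hL₁]
  have hUD := mul_le_mul_of_nonneg_left hD hU
  linarith

/-- **Chord inequality in `t'`** (concavity of `t' ↦ E^{tt'}(U)`, `H^{tt'}` being affine in `t'`): for
a unit sector ground state `ψ` at `(t', U)` and every `t₃`,
`E^{t t₃}(U) ≤ E^{t t'}(U) - 2 (t₃ - t') K_d(ψ)` (`L ≥ 3`). -/
theorem sectorEnergyTT'_le_sub_mul_kinWeightDiag (hL : 3 ≤ L) {t' U : ℝ} {N : ℕ} {M : ℝ}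
    {ψ : Fock (Orb (FermionTorus 2 L))} (hgs : IsGroundStateInSector (hubbardTorusTT' L 1 t' U) N M ψ)
    (h1 : star ψ ⬝ᵥ ψ = 1) (t₃ : ℝ) :
    sectorEnergyTT' L t₃ U N M ≤ sectorEnergyTT' L t' U N M - 2 * (t₃ - t') * kinWeightDiag ψ := by
  have h := minEnergyOn_le_rayleigh_of_mem (hubbardTorusTT'_isHermitian L 1 t₃ U) _ hgs.1 h1
  rw [re_expect_hubbardTorusTT'_eq_kin hL t₃ U ψ] at h
  have h' := re_expect_hubbardTorusTT'_eq_kin hL t' U ψ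
  rw [re_expect_eq_sectorEnergyTT' hgs h1] at h'
  change (hubbardTorusTT' L 1 t₃ U).minEnergyOn (szSector N M) ≤ _
  nlinarith [h, h']

/-- **Diagonal kinetic bracket from a `t'`-bracket**: for `t' ≤ 0`, `t₃ < t'`, a unit sector ground
state `ψ` at `(t', U)` with `E^{tt'}(U) ≤ R` and a lower bracket `L₃ ≤ E^{t t₃}(U)` has
`2 t' K_d(ψ) ≤ t' (R - L₃)/(t₃ - t')` (the right-hand side is `|t'| (R - L₃)/(t' - t₃) ≥ 0` when
`L₃ ≤ R`). -/
theorem two_mul_tPrime_mul_kinWeightDiag_le (hL : 3 ≤ L) {t' t₃ U : ℝ} (ht' : t' ≤ 0) (ht₃ : t₃ < t')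
    {N : ℕ} {M : ℝ} {ψ : Fock (Orb (FermionTorus 2 L))}
    (hgs : IsGroundStateInSector (hubbardTorusTT' L 1 t' U) N M ψ) (h1 : star ψ ⬝ᵥ ψ = 1)
    {R L₃ : ℝ} (hR : sectorEnergyTT' L t' U N M ≤ R) (hL₃ : L₃ ≤ sectorEnergyTT' L t₃ U N M) :
    2 * (t' * kinWeightDiag ψ) ≤ t' * ((R - L₃) / (t₃ - t')) := by
  have hch := sectorEnergyTT'_le_sub_mul_kinWeightDiag hL hgs h1 t₃
  have hneg : t₃ - t' < 0 := sub_neg.2 ht₃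
  have hK : (R - L₃) / (t₃ - t') ≤ 2 * kinWeightDiag ψ := by
    rw [div_le_iff_of_neg hneg]
    nlinarith [hch, hR, hL₃]
  have h := mul_le_mul_of_nonpos_left hK ht'
  rw [mul_left_comm] at h
  exact h

/-- **Certified-bracket stiffness ceiling, `t–t'` class, `t' ≤ 0` (PROVED below).** For `L ≥ 3`,
`δ ≥ -1`, `t' ≤ 0`, `t₃ < t'`, `U ≥ 0`, `U₁ < U`: a flux stiffness `ρ_s` of the twisted `t–t'` torus
in the sector `(N_L, S^z = 0)` (`ρ_s θ² ≤ E^{tt'}_L(θ) - E^{tt'}_L(0)`, `|θ| ≤ θ₀`) obeys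
`ρ_s L² ≤ (U (R - L₁)/(U - U₁) - Em + t' (R - L₃)/(t₃ - t')) / 4`
for all brackets `Em ≤ E^{tt'}_L(U; 0) ≤ R`, `L₁ ≤ E^{tt'}_L(U₁; 0)` (same `t'`) and
`L₃ ≤ E^{t t₃}_L(U; 0)` (same `U`, a more negative `t₃`). The extra `t'`-chord term is forced: the
`x`-twist floor is `ρ_s L² ≤ K_x + t' K_d` (every diagonal bond crosses the seam), so the rotation
average bounds `ρ_s L²` by `¼⟨-T⟩ + ½ t' K_d`, and `t' K_d = |t'|(-K_d)` needs its own bracket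
(`∂E/∂t' = -2 K_d`). At `t' = 0` it is `StiffnessCeilingFromEnergyBrackets`
(`stiffnessCeilingFromEnergyBrackets_of_TT'`). -/
@[conjecture] def StiffnessCeilingFromEnergyBracketsTT' : Prop :=
  ∀ (L : ℕ) [NeZero L], 3 ≤ L → ∀ (t' t₃ U U₁ δ ρs θ₀ : ℝ), -1 ≤ δ → t' ≤ 0 → t₃ < t' → 0 ≤ U →
    U₁ < U → 0 < ρs → 0 < θ₀ →
    (∀ θ : ℝ, |θ| ≤ θ₀ → ρs * θ ^ 2 ≤ fluxEnergyTT' L t' U δ θ - fluxEnergyTT' L t' U δ 0) →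
    ∀ (Em R L₁ L₃ : ℝ), Em ≤ fluxEnergyTT' L t' U δ 0 → fluxEnergyTT' L t' U δ 0 ≤ R →
      L₁ ≤ fluxEnergyTT' L t' U₁ δ 0 → L₃ ≤ fluxEnergyTT' L t₃ U δ 0 →
      ρs * (L : ℝ) ^ 2 ≤ (U * ((R - L₁) / (U - U₁)) - Em + t' * ((R - L₃) / (t₃ - t'))) / 4

/-- **Proof of `StiffnessCeilingFromEnergyBracketsTT'`** (floors on `ψ` and `Γ(r)ψ`;
`K_y(Γψ) = K_x(ψ)`, `K_d(Γψ) = K_d(ψ)`; `U`-chord for `Γψ`, `t'`-chord for `ψ`). -/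
theorem stiffnessCeilingFromEnergyBracketsTT'_holds : StiffnessCeilingFromEnergyBracketsTT' := by
  intro L _ hL t' t₃ U U₁ δ ρs θ₀ hδ ht' ht₃ hU hU₁ hρs hθ₀ hst Em R L₁ L₃ hEm hR hL₁ hL₃
  obtain ⟨ψ, h1, hgs⟩ := exists_unit_groundStateInSector_hubbardTorusTT' L 1 t' U
    (NoGo.floor_pairNumber_le δ hδ L)
  set φ : Fock (Orb (FermionTorus 2 L)) :=
    fockMapOp (d4Orb (DihedralGroup.r 1 : DihedralGroup 4)) *ᵥ ψ with hφ_def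
  have hφgs : IsGroundStateInSector (hubbardTorusTT' L 1 t' U) (2 * ⌊(1 - δ) * (L : ℝ) ^ 2 / 2⌋₊) 0 φ :=
    isGroundStateInSector_hubbardTorusTT'_rot hgs
  have hφ1 : star φ ⬝ᵥ φ = 1 := by
    rw [hφ_def, star_fockMapOp_mulVec_dotProduct_self _ (d4Orb_bijective _).injective, h1]
  have hKy : kinWeightDir 1 φ = kinWeightDir 0 ψ := kinWeightDir_one_rot ψ
  have hKd : kinWeightDiag φ = kinWeightDiag ψ := kinWeightDiag_rot ψ
  have hfψ : ρs * (L : ℝ) ^ 2 ≤ kinWeightDir 0 ψ + t' * kinWeightDiag ψ := by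
    have h := stiffnessTT'_mul_sq_le_kinetic_of_isGroundStateInSector hL t' U δ hρs hθ₀ hst hgs h1
    rw [sum_shiftKinWeight_eq_kinWeightDiag] at h
    refine h.trans (le_of_eq ?_)
    rfl
  have hfφ : ρs * (L : ℝ) ^ 2 ≤ kinWeightDir 0 φ + t' * kinWeightDiag φ := by
    have h := stiffnessTT'_mul_sq_le_kinetic_of_isGroundStateInSector hL t' U δ hρs hθ₀ hst hφgs hφ1
    rw [sum_shiftKinWeight_eq_kinWeightDiag] at h
    refine h.trans (le_of_eq ?_)
    rfl
  rw [hKd] at hfφ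
  rw [fluxEnergyTT'_zero_eq_sectorEnergyTT' (L := L) t' U δ] at hEm hR
  rw [fluxEnergyTT'_zero_eq_sectorEnergyTT' (L := L) t' U₁ δ] at hL₁
  rw [fluxEnergyTT'_zero_eq_sectorEnergyTT' (L := L) t₃ U δ] at hL₃
  have hb := two_mul_kinWeightTT'_le_of_energyBrackets hL hU hU₁ hφgs hφ1 hEm hR hL₁
  rw [hKy, hKd] at hb
  have ht := two_mul_tPrime_mul_kinWeightDiag_le hL ht' ht₃ hgs h1 hR hL₃
  linarith

/-- Consistency at `t' = 0`: the `t–t'` ceiling specialises to the nearest-neighbour one (the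
`t'`-chord term vanishes; take `t₃ = -1`, `L₃ = E^{t,-1}_L(U; 0)`). -/
theorem stiffnessCeilingFromEnergyBrackets_of_TT' (h : StiffnessCeilingFromEnergyBracketsTT') :
    StiffnessCeilingFromEnergyBrackets := by
  intro L _ hL U U₁ δ ρs θ₀ hδ hU hU₁ hρs hθ₀ hst Em R L₁ hEm hR hL₁
  have h' := h L hL 0 (-1) U U₁ δ ρs θ₀ hδ le_rfl (by norm_num) hU hU₁ hρs hθ₀
    (by simpa only [fluxEnergyTT'_tPrime_zero] using hst) Em R L₁ (fluxEnergyTT' L (-1) U δ 0)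
    (by simpa only [fluxEnergyTT'_tPrime_zero] using hEm)
    (by simpa only [fluxEnergyTT'_tPrime_zero] using hR)
    (by simpa only [fluxEnergyTT'_tPrime_zero] using hL₁) le_rfl
  linarith


end Summit.HubbardSuperconductivity.HubbardLadder.Bounds

end
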